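import Summits.HodgeConjecture.HodgeConjecture.Theorems.MarkmanPartnerTransportLowPicardRMCellGen

/-!
# Route MarkmanPartnerTransport · crux #5 `LowPicardRealMultiplication` — «CELL-GEN», prime degree: in a cell whose
# RM field has PRIME degree `d`, ANY irrational `σ`-eigenvalue already has degree `d`, so ONE cycle with an irrational
# eigenvalue generates

Sequel to `…LowPicardRMCellGen` (planner p1 g39 GO «CELL-GEN SOCKET»; prover seat hodge-nonav-20241-p1, gen 15);
route-independent. For a marked smooth projective `(X, φ, P, z)` with `RMgen[X, φ, z, d]` (generator `θ`, `θ σ = ev_θ σ`,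
`deg minpoly_ℚ ev_θ = d`, GEN):

* `exists_eigenvalue_eq_aeval_of_rmGenerator` — the `σ`-eigenvalue `ev` of ANY rational type-preserving endomorphism
  `t` is a rational polynomial in `ev_θ`: `ev = P(ev_θ)` (GEN at `σ ∈ T`); in particular `ℚ(ev) ⊆ ℚ(ev_θ) = E`.
* `natDegree_minpoly_eq_of_prime_of_irrational` — degree count in `ℂ`: `y = P(x)`, `deg minpoly_ℚ x = d` PRIME, `y ∉ ℚ`
  ⟹ `deg minpoly_ℚ y = d` (`[ℚ(y):ℚ]` divides the prime `d` and is not `1`).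
* `genX_of_rmGenerator_of_irrational_of_prime` — **for `d` prime, a rational type-preserving `t` with an IRRATIONAL
  `σ`-eigenvalue has `GenX[X, φ, t]`** (`genX_of_rmGenerator_of_eigenvalue_natDegree` at the degree just computed).
  Five of the six cells of crux #5 have prime `d ∈ {2, 3, 5, 7}` — `(1,2), (2,3), (2,7), (3,2), (3,5)`; only `(3,4)`
  needs the eigenvalue degree to be EXACTLY `4` (a quadratic eigenvalue there generates a quadratic subfield only).

No `K3^{[2]}`-type hypothesis, no definition, no sorry, no named-fact hypothesis. Consumer: `…LowPicardRMCellGenSocket`.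
`--supports stmt-HodgeConjecture-19653`. Nothing here proves the crux or HC.

References: Yu. Zarhin, J. reine angew. Math. 341 (1983) Thm. 1.5.1; B. van Geemen, Michigan Math. J. 56 (2008)
Lemma 3.2; D. Huybrechts, *Lectures on K3 Surfaces*, Ch. 3 Cor. 3.3.6.
-/

noncomputable section

set_option linter.dupNamespace false

open Module CategoryTheory Polynomial
open Literature.AlgebraicTopology.SingularHomology Literature.Geometry.Kaehler
open Literature.AlgebraicGeometry Literature.AlgebraicGeometry.Motives Literature.AlgebraicGeometry.HodgeTheory
open Literature.AlgebraicGeometry.Hyperkaehler Literature.AlgebraicGeometry.Surfaces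
open Summit.HodgeConjecture.HodgeConjecture.Theorems.NikulinTwinTransport

namespace Summit.HodgeConjecture.HodgeConjecture.Theorems.MarkmanPartnerTransport.PartnerLattice

/-- `MarkedK3Sq[X, φ, P, z]`: VERBATIM the `let MarkedK3Sq := …` binder of the route declarations of
MarkmanPartnerTransport (clauses (m1)–(m6)). Local notation only. -/
local notation3 (prettyPrint := false) "MarkedK3Sq[" X ", " φ ", " P ", " z "]" =>
  (((IsIntegralClass P ∧ ∀ Q : complexBetti X (2 * 4), IsIntegralClass Q → ∃ n : ℤ, Q = n • P) ∧
    (∀ c : complexBetti X 2, IsIntegralClass c ↔ ∃ v : K3HilbertIndex → ℤ, φ c = fun i => (v i : ℂ)) ∧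
    (∀ a : complexBetti X 2, cupPowTwo a 4 = ((3 : ℂ) * (k3HilbertForm 2 (φ a) (φ a)) ^ 2) • P) ∧
    (IsOfHodgeType 4 X 2 2 0 (LinearEquiv.symm φ z) ∧
      ∀ τ : complexBetti X 2, IsOfHodgeType 4 X 2 2 0 τ → ∃ t : ℂ, τ = t • LinearEquiv.symm φ z) ∧
    (∀ c : complexBetti X 2, IsOfHodgeType 4 X 2 1 1 c ↔
      (k3HilbertForm 2 (φ c) z = 0 ∧ k3HilbertForm 2 (φ c) (star z) = 0)) ∧
    (k3HilbertForm 2 z z = 0 ∧ 0 < (k3HilbertForm 2 (star z) z).re)))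

/-- `RMgen[X, φ, z, d]` (VERBATIM `…LowPicardRMCells`). Local notation only. -/
local notation3 (prettyPrint := false) "RMgen[" X ", " φ ", " z ", " d "]" =>
  (∃ θ : complexBetti X 2 →ₗ[ℂ] complexBetti X 2, (∀ y, IsRationalClass y → IsRationalClass (θ y)) ∧
    (∀ (i j : ℕ) y, IsOfHodgeType 4 X 2 i j y → IsOfHodgeType 4 X 2 i j (θ y)) ∧
    (∀ y w : complexBetti X 2, k3HilbertForm 2 (φ (θ y)) (φ w) = k3HilbertForm 2 (φ y) (φ (θ w))) ∧
    ∃ ev : ℂ, θ (LinearEquiv.symm φ z) = ev • LinearEquiv.symm φ z ∧ ev.im = 0 ∧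
      (minpoly ℚ ev).natDegree = d ∧
      (∃ n : ℕ, 3 ≤ n ∧ d * n + Module.finrank ℂ ↥(algebraicClasses X 1) = 23) ∧
      ∀ f : complexBetti X 2 →ₗ[ℂ] complexBetti X 2, (∀ y, IsRationalClass y → IsRationalClass (f y)) →
        (∀ (i j : ℕ) y, IsOfHodgeType 4 X 2 i j y → IsOfHodgeType 4 X 2 i j (f y)) →
        ∃ c : Fin d → ℚ, ∀ y : complexBetti X 2,
          (∀ a : complexBetti X 2, a ∈ algebraicClasses X 1 → k3HilbertForm 2 (φ y) (φ a) = 0) →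
            f y = ∑ i : Fin d, ((c i : ℂ) • (θ ^ (i : ℕ)) y))

/-- `GenX[X, φ, e]` (VERBATIM `…K3Sq2OneCycle`). Local notation only. -/
local notation3 (prettyPrint := false) "GenX[" X ", " φ ", " e "]" =>
  (∀ f : complexBetti X 2 →ₗ[ℂ] complexBetti X 2, (∀ y, IsRationalClass y → IsRationalClass (f y)) →
      (∀ (i j : ℕ) y, IsOfHodgeType 4 X 2 i j y → IsOfHodgeType 4 X 2 i j (f y)) →
      (∀ d : complexBetti X 2, d ∈ algebraicClasses X 1 → f d = 0) →
      (∀ y : complexBetti X 2, ∀ d : complexBetti X 2, d ∈ algebraicClasses X 1 →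
        k3HilbertForm 2 (φ (f y)) (φ d) = 0) →
      ∃ (n : ℕ) (a : Fin n → ℚ), ∀ y : complexBetti X 2,
        (∀ d : complexBetti X 2, d ∈ algebraicClasses X 1 → k3HilbertForm 2 (φ y) (φ d) = 0) →
        f y = ∑ i : Fin n, ((a i : ℂ) • (e ^ (i : ℕ)) y))

variable {X : SchemeOver ℂ} {φ : complexBetti X 2 ≃ₗ[ℂ] (K3HilbertIndex → ℂ)} {P : complexBetti X (2 * 4)}
  {z : K3HilbertIndex → ℂ}

/-- **In a cell, every `σ`-eigenvalue lies in `ℚ(ev_θ)`**: for `RMgen[X, φ, z, d]` with generator eigenvalue `ev_θ` and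
a rational type-preserving `t` with `t σ = ev σ`, `ev = P(ev_θ)` for some `P ∈ ℚ[X]` (GEN at `σ`, which lies in the
`T`-domain by (m5)). Stated as `∃ x, deg minpoly_ℚ x = d ∧ ∃ P, ev = P(x)` since `θ` is bound inside `RMgen`.
[cite: Zarhin1983HodgeGroupsK3, Thm. 1.5.1] [cite: Huybrechts2016K3, Ch. 3 Cor. 3.3.6] -/
theorem exists_eigenvalue_eq_aeval_of_rmGenerator (hX : IsSmoothProjective 4 X) (hM : MarkedK3Sq[X, φ, P, z]) {d : ℕ}
    (hR : RMgen[X, φ, z, d]) (t : complexBetti X 2 →ₗ[ℂ] complexBetti X 2)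
    (ht_rat : ∀ y, IsRationalClass y → IsRationalClass (t y))
    (ht_typ : ∀ (i j : ℕ) y, IsOfHodgeType 4 X 2 i j y → IsOfHodgeType 4 X 2 i j (t y))
    {ev : ℂ} (ht_ev : t (LinearEquiv.symm φ z) = ev • LinearEquiv.symm φ z) :
    ∃ x : ℂ, (minpoly ℚ x).natDegree = d ∧ ∃ P : ℚ[X], ev = aeval x P := by
  obtain ⟨-, -, -, -, h11, -, hzpos⟩ := id hM
  obtain ⟨θ, -, -, -, evθ, hθσ, -, hdegθ, -, hG⟩ := hR
  have hzne : z ≠ 0 := by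
    intro h0
    rw [h0, k3HilbertForm_eq_dotProduct] at hzpos
    simp at hzpos
  have hσne : (LinearEquiv.symm φ z) ≠ 0 := fun h => hzne (by simpa using congrArg φ h)
  have hN11 : ∀ a ∈ algebraicClasses X 1, IsOfHodgeType 4 X 2 1 1 a := fun a ha =>
    isOfHodgeType_of_mem_algebraicClasses_of_isSmoothProjective hX 1 ha
  have hσT : ∀ a ∈ algebraicClasses X 1, k3HilbertForm 2 (φ (LinearEquiv.symm φ z)) (φ a) = 0 := by
    intro a ha
    rw [LinearEquiv.apply_symm_apply, k3HilbertForm_comm]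
    exact ((h11 a).1 (hN11 a ha)).1
  obtain ⟨c, hc⟩ := hG t ht_rat ht_typ
  refine ⟨evθ, hdegθ, ∑ i : Fin d, monomial (i : ℕ) (c i), ?_⟩
  have h := hc _ hσT
  rw [ht_ev] at h
  simp_rw [pow_apply_of_eigen θ hθσ, smul_smul] at h
  rw [← Finset.sum_smul] at h
  rw [smul_left_injective ℂ hσne h, map_sum]
  exact Finset.sum_congr rfl fun i _ => by rw [aeval_monomial, eq_ratCast]

/-- **Degree count in `ℂ`, prime case**: `y = P(x)` with `deg minpoly_ℚ x = d` PRIME and `y` irrational ⟹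
`deg minpoly_ℚ y = d` (`[ℚ(y):ℚ] ∣ [ℚ(x):ℚ] = d`, and `[ℚ(y):ℚ] = 1` would put `y` in `ℚ`). [folklore] -/
theorem natDegree_minpoly_eq_of_prime_of_irrational {x y : ℂ} {P : ℚ[X]} (hxy : y = aeval x P) {d : ℕ}
    (hp : d.Prime) (hx : (minpoly ℚ x).natDegree = d) (hy : ∀ a : ℚ, (a : ℂ) ≠ y) :
    (minpoly ℚ y).natDegree = d := by
  have hxi : IsIntegral ℚ x := by
    by_contra h
    rw [minpoly.eq_zero h, Polynomial.natDegree_zero] at hx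
    exact hp.ne_zero hx.symm
  have hyK : y ∈ IntermediateField.adjoin ℚ {x} := by
    have h : y ∈ (IntermediateField.adjoin ℚ {x}).toSubalgebra := by
      apply IntermediateField.algebra_adjoin_le_adjoin
      rw [Algebra.adjoin_singleton_eq_range_aeval]
      exact ⟨P, hxy.symm⟩
    exact h
  have hle : IntermediateField.adjoin ℚ {y} ≤ IntermediateField.adjoin ℚ {x} := by
    rw [IntermediateField.adjoin_simple_le_iff]
    exact hyK
  haveI : FiniteDimensional ℚ (IntermediateField.adjoin ℚ {x}) := IntermediateField.adjoin.finiteDimensional hxi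
  have hyi : IsIntegral ℚ y := by
    have halg : IsAlgebraic ℚ (⟨y, hyK⟩ : IntermediateField.adjoin ℚ {x}) := Algebra.IsAlgebraic.isAlgebraic _
    exact (IntermediateField.isAlgebraic_iff.1 halg).isIntegral
  have hdvd : Module.finrank ℚ (IntermediateField.adjoin ℚ {y}) ∣ d := by
    rw [← hx, ← IntermediateField.adjoin.finrank hxi]
    exact IntermediateField.finrank_dvd_of_le_right hle
  rcases (Nat.dvd_prime hp).1 hdvd with h1 | hd
  · exfalso
    rw [IntermediateField.finrank_adjoin_simple_eq_one_iff, IntermediateField.mem_bot] at h1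
    obtain ⟨a, ha⟩ := h1
    exact hy a (by rw [← ha, eq_ratCast])
  · rw [IntermediateField.adjoin.finrank hyi] at hd
    exact hd

/-- **«CELL-GEN» at prime degree** (module docstring): `RMgen[X, φ, z, d]` with `d` PRIME and a rational type-preserving
`t` with an IRRATIONAL `σ`-eigenvalue ⟹ `GenX[X, φ, t]`. Applies to the cells `(1,2), (2,3), (2,7), (3,2), (3,5)` of
crux #5 (`d ∈ {2, 3, 7, 2, 5}`). [cite: Zarhin1983HodgeGroupsK3, Thm. 1.5.1] [cite: Vangeemen2008, Lemma 3.2] -/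
theorem genX_of_rmGenerator_of_irrational_of_prime (hX : IsSmoothProjective 4 X) (hM : MarkedK3Sq[X, φ, P, z])
    {d : ℕ} (hp : d.Prime) (hR : RMgen[X, φ, z, d]) (t : complexBetti X 2 →ₗ[ℂ] complexBetti X 2)
    (ht_rat : ∀ y, IsRationalClass y → IsRationalClass (t y))
    (ht_typ : ∀ (i j : ℕ) y, IsOfHodgeType 4 X 2 i j y → IsOfHodgeType 4 X 2 i j (t y))
    {ev : ℂ} (ht_ev : t (LinearEquiv.symm φ z) = ev • LinearEquiv.symm φ z) (hev : ∀ a : ℚ, (a : ℂ) ≠ ev) :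
    GenX[X, φ, t] := by
  obtain ⟨x, hx, Q, hQ⟩ := exists_eigenvalue_eq_aeval_of_rmGenerator hX hM hR t ht_rat ht_typ ht_ev
  exact genX_of_rmGenerator_of_eigenvalue_natDegree hX hM hR t ht_rat ht_typ ht_ev
    (natDegree_minpoly_eq_of_prime_of_irrational hQ hp hx hev)

end Summit.HodgeConjecture.HodgeConjecture.Theorems.MarkmanPartnerTransport.PartnerLattice

end
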